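import Summits.QuantumFields.BalabanUV.T4Continuum.Support.VariationalCovariantUpperBound
import Summits.QuantumFields.BalabanUV.T4Continuum.Support.VariationalCovariantWeights

/-!
# T⁴ programme, spine node NE2 (U1a), lane P2 — SUPPLIER LEAF ONE⁺ OF THE VARIATIONAL ROUTE, PART 1: THE EXPLICIT COVARIANT
# ONE-STEP INTERPOLANT (objects, exact constraint, exact bond identities, pointwise bounds) — model level (U(1) charged scalar)

NE2 formalisation swarm `b2b-balaban-t4-ne2-formalise-*`, leaf 01 GEN 2 (`prover-b2b-balaban-t4-ne2-formalise-leaf-01-g2-0`), acting as a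
SUPPLIER SEAT for leaf ONE⁺ of the P2 (variational) skeleton `t4/skeletons/NE2-t4-ne2-p2.md` v0.6 §2.C ∕ §7 («s5 ONE⁺: one-step consistency
at the coarse field, ADDITIVE, by an EXPLICIT covariant competitor»); journal CLAIM CLAIMS.log l.8374 (+ erratum l.8383).  Carriers = those of
P2's leaves FED⁺ ∕ P⁺ ∕ UB⁺ (`VariationalCovariantFederbush` p210720, `VariationalCovariantPoincare` p211276, `VariationalCovariantUpperBound`):
coarse torus `Tor N`, fine torus `Tor (fine L N)` with blocks `B(y) = {bpt L N y j}` ([Balaban1984PropagatorsI] (1.6), tree `B5Block118.bpt`),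
coarse covariant difference `cD N Rc f y μ = Rc(y,μ)f(y+e_μ) − f(y)` ([Balaban1985BackgroundPropagators] (3.3) p.390, SHAPE only, abelian),
transported one-step average `Qc L N T′ f′ y = L^{−d}Σ_j T′(bpt y j)·f′(bpt y j)` ((3.19) p.393, SHAPE only, abelian).

HONEST FRAMING (T4-DAG p. 1).  Rung (B)+1 only — NOT infinite volume, NOT a mass gap, NOT Clay.  Node NE2 is NOT IN PRINT and NOT proved
here.  MODEL LEVEL: coarse bond phases `Rc` (`|Rc| = 1`), fine bond phases `R′`, unit-modulus one-step site transports `T′` are DATA; lattice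
units; scalar (0-form) sector; ONE block step of side `L` — no `k`, no tower, no rate, nothing of node NE3.  What is proved is OURS and
elementary; nothing printed is a hypothesis; no `def … : Prop`; no `sorry`; axioms standard.  HONEST DEPENDENCY (cell, verbatim): continuum
YM on T⁴ ⇐ BetaPertH ∧ nine spine estimates (0/9 proved); BetaPertH ⇐ (D1) ∧ (D4) ∧ CAP+tail; G-an2-4 gates asym, D1 and NE2/3/4.

THE COMPETITOR (this file).  For a coarse field `λ : Tor N → ℂ` the fine field

  `Λ′(bpt y j) := conj T′(bpt y j) · Φ(y, j)`,   `Φ(y, j) := λ(y) + Σ_ν w_L(j_ν)·(D⁺_ν λ)(y)`,   `w_L(i) = (2i + 1 − L)/(2L)`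

(the centred FORWARD-Taylor interpolant of `λ` in the frame of the block label `y`, carried to the fine sites by the one-step transports).  Then:
  * `Σ_i w_L(i) = 0` ⇒ **the transported constraint holds EXACTLY**, `Qc L N T′ Λ′ = λ` (`Qc_interp`) — no block-mean correction;
  * EXACT BOND IDENTITIES: on an IN-BLOCK μ-bond the frame-`y` increment is `(1/L)·(D⁺_μλ)(y)` (`Phi_succ_sub`); on a bond CROSSING to block
    `y + e_μ` it is `(1/L)·(D⁺_μλ)(y) + Σ_ν w_L(j⁰_ν)·(D⁺_μ D⁺_ν λ)(y)` (`Rc_mul_Phi_sub`) — a SECOND covariant difference; the fine covariant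
    difference of `Λ′` is `conj T′(x)·(that increment) + (one-step transport DEFECT)·conj T′(x)·Φ(next)` (`cov_diff_split` of the UB⁺ file ∕
    `cov_diff_split_cross`), with the two ONE-BLOCK DEFECTS AS DATA: in-block `R′(x,μ)·conj T′(x+e_μ)·T′(x) − 1` (the UB⁺ file's `hw`) and
    block-crossing `R′(x,μ)·conj T′(x+e_μ)·T′(x) − Rc(y,μ)` (the nature of FED⁺'s `mis`), both `≤ m`;
  * POINTWISE BOUND `norm_cD_interp_le`; the size `Σ_{y,j}|Φ(y,j)|² ≤ 2(1+d²)·L^d·Σ|λ|²` (`nsq_PhiF_le`).  The weight bookkeeping and the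
    cross-term identity that make the main term's constant EXACTLY 1 in part 2 (`VariationalCovariantOneStep`) are in part 0
    (`VariationalCovariantWeights`).
The regularity functional served to leaf REG⁺ is the FULL FORWARD COVARIANT HESSIAN `hess N Rc λ = Σ_{μ,ν,y}|(D⁺_μ D⁺_ν λ)(y)|²`
(physical units `rho n M Rc λ = n⁴/n^d·hess`).
-/

noncomputable section

namespace Summit.QuantumFields.BalabanUV.T4Continuum.VariationalCovariantInterpolant

open Finset
open scoped ComplexConjugate
open Literature.MathematicalPhysics.QuantumFieldTheory.Balaban1983to89
open Literature.MathematicalPhysics.QuantumFieldTheory.Balaban1983to89.B5Prop11Plancherel (Tor fine unitVec)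
open Literature.MathematicalPhysics.QuantumFieldTheory.Balaban1983to89.B5Prop11Lower (nsq nsq_nonneg)
open Literature.MathematicalPhysics.QuantumFieldTheory.Balaban1983to89.B5Block118 (bpt)
open Literature.MathematicalPhysics.QuantumFieldTheory.Balaban1983to89.B5Blocks16 (blockOf blockOf_bpt)
open Literature.MathematicalPhysics.QuantumFieldTheory.Balaban1983to89.B5AverageCurlStokes (sum_blocks_real sum_translate)
open Summit.QuantumFields.BalabanUV.T4Continuum.ScalarBlockTrialFunction (digits digits_bpt bpt_add_unitVec_of_lt bpt_add_unitVec_of_eq)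
open Summit.QuantumFields.BalabanUV.T4Continuum.VariationalCovariantFederbush (cD dirU Qc dirU_nonneg)
open Summit.QuantumFields.BalabanUV.T4Continuum.VariationalCovariantUpperBound (mul_conj_of_norm_one cov_diff_split norm_cov_diff_le)
open Summit.QuantumFields.BalabanUV.T4Continuum.VariationalCovariantWeights
  (wt wt_succ_sub one_add_wt_zero_sub abs_wt_le sum_wt_coord)

variable {d : ℕ}

/-! ## §1 The interpolant in the block frames, the fine competitor, the regularity functional -/

section Objects

variable (L : ℕ) [NeZero L] (N : Fin d → ℕ) [∀ μ, NeZero (N μ)]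

/-- the centred forward-Taylor interpolant of `λ` in the frame of the block label `y`, read at the offset `j`:
`Φ(y, j) = λ(y) + Σ_ν w_L(j_ν)·(D⁺_ν λ)(y)`. [folklore] -/
def Phi (Rc : Tor N → Fin d → ℂ) (lam : Tor N → ℂ) (y : Tor N) (j : Fin d → Fin L) : ℂ :=
  lam y + ∑ ν, ((wt L (j ν) : ℝ) : ℂ) * cD N Rc lam y ν

/-- the interpolant as a fine field in the block frames: `Φ(block x, digits x)`. [folklore] -/
def PhiF (Rc : Tor N → Fin d → ℂ) (lam : Tor N → ℂ) : Tor (fine L N) → ℂ :=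
  fun x => Phi L N Rc lam (blockOf L N x) (digits L N x)

/-- **THE COMPETITOR**: `Λ′(x) = conj T′(x)·Φ(block x, digits x)` — the interpolant carried to the fine sites by the one-step transports.
[folklore] -/
def interp (T' : Tor (fine L N) → ℂ) (Rc : Tor N → Fin d → ℂ) (lam : Tor N → ℂ) : Tor (fine L N) → ℂ :=
  fun x => conj (T' x) * PhiF L N Rc lam x

/-- the FULL FORWARD COVARIANT HESSIAN (lattice units): `hess λ = Σ_μ Σ_ν Σ_y |(D⁺_μ (D⁺_ν λ))(y)|²` — the regularity functional `ρ` of leaf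
ONE⁺, to be bounded at coarse minimisers by leaf REG⁺. [folklore] -/
def hess (Rc : Tor N → Fin d → ℂ) (lam : Tor N → ℂ) : ℝ := ∑ μ, ∑ ν, dirU N Rc (fun z => cD N Rc lam z ν) μ

/-- the Hessian functional is nonnegative. [folklore] -/
theorem hess_nonneg (Rc : Tor N → Fin d → ℂ) (lam : Tor N → ℂ) : 0 ≤ hess N Rc lam :=
  sum_nonneg fun _ _ => sum_nonneg fun _ _ => dirU_nonneg _ _ _ _

/-- `Φ` read at a block point. [folklore] -/
theorem PhiF_bpt (Rc : Tor N → Fin d → ℂ) (lam : Tor N → ℂ) (y : Tor N) (j : Fin d → Fin L) :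
    PhiF L N Rc lam (bpt L N y j) = Phi L N Rc lam y j := by
  rw [PhiF, blockOf_bpt, digits_bpt]

/-- `Λ′` read at a block point. [folklore] -/
theorem interp_bpt (T' : Tor (fine L N) → ℂ) (Rc : Tor N → Fin d → ℂ) (lam : Tor N → ℂ) (y : Tor N) (j : Fin d → Fin L) :
    interp L N T' Rc lam (bpt L N y j) = conj (T' (bpt L N y j)) * Phi L N Rc lam y j := by
  rw [interp, PhiF_bpt]

/-- `|Λ′(x)| = |Φ(block x, digits x)|` for unit transports. [folklore] -/
theorem norm_interp {T' : Tor (fine L N) → ℂ} (hT1 : ∀ x, ‖T' x‖ = 1) (Rc : Tor N → Fin d → ℂ) (lam : Tor N → ℂ)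
    (x : Tor (fine L N)) : ‖interp L N T' Rc lam x‖ = ‖PhiF L N Rc lam x‖ := by
  rw [interp, norm_mul, Complex.norm_conj, hT1, one_mul]

variable (Rc : Tor N → Fin d → ℂ) (lam : Tor N → ℂ)

omit [NeZero L] [∀ μ, NeZero (N μ)] in
/-- moving one offset digit changes exactly one weight: `Σ_ν w(j[μ↦a]_ν)X_ν − Σ_ν w(j_ν)X_ν = (w(a) − w(j_μ))·X_μ`. [folklore] -/
theorem sum_update_wt_sub (X : Fin d → ℂ) (j : Fin d → Fin L) (μ : Fin d) (a : Fin L) :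
    ∑ ν, ((wt L (Function.update j μ a ν) : ℝ) : ℂ) * X ν - ∑ ν, ((wt L (j ν) : ℝ) : ℂ) * X ν
      = (((wt L a - wt L (j μ)) : ℝ) : ℂ) * X μ := by
  classical
  rw [← Finset.sum_sub_distrib]
  have h : ∀ ν, ((wt L (Function.update j μ a ν) : ℝ) : ℂ) * X ν - ((wt L (j ν) : ℝ) : ℂ) * X ν
      = if ν = μ then (((wt L a - wt L (j μ)) : ℝ) : ℂ) * X μ else 0 := by
    intro ν
    by_cases hν : ν = μ
    · subst hν; rw [Function.update_self, if_pos rfl]; push_cast; ring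
    · rw [Function.update_of_ne hν, if_neg hν, sub_self]
  rw [Finset.sum_congr rfl fun ν _ => h ν, Finset.sum_ite_eq' Finset.univ μ, if_pos (Finset.mem_univ μ)]

omit [∀ μ, NeZero (N μ)] in
/-- **IN-BLOCK INCREMENT, EXACT**: `Φ(y, j[μ ↦ j_μ+1]) − Φ(y, j) = (1/L)·(D⁺_μ λ)(y)`. [folklore] -/
theorem Phi_succ_sub (y : Tor N) (j : Fin d → Fin L) (μ : Fin d) (h : (j μ : ℕ) + 1 < L) :
    Phi L N Rc lam y (Function.update j μ ⟨(j μ : ℕ) + 1, h⟩) - Phi L N Rc lam y j = ((L : ℂ))⁻¹ * cD N Rc lam y μ := by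
  unfold Phi
  rw [add_sub_add_left_eq_sub, sum_update_wt_sub L (fun ν => cD N Rc lam y ν) j μ ⟨(j μ : ℕ) + 1, h⟩]
  have hw : wt L ((⟨(j μ : ℕ) + 1, h⟩ : Fin L) : ℕ) - wt L (j μ) = 1 / L := wt_succ_sub L (j μ)
  rw [hw]
  push_cast
  rw [one_div]

omit [∀ μ, NeZero (N μ)] in
/-- **BLOCK-CROSSING INCREMENT, EXACT** (frame `y`; `j_μ = L−1`, `j⁰ = j[μ ↦ 0]`):
`Rc(y,μ)·Φ(y+e_μ, j⁰) − Φ(y, j) = (1/L)·(D⁺_μλ)(y) + Σ_ν w_L(j⁰_ν)·(D⁺_μ D⁺_ν λ)(y)` — a second covariant difference. [folklore] -/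
theorem Rc_mul_Phi_sub (y : Tor N) (j : Fin d → Fin L) (μ : Fin d) (h : (j μ : ℕ) + 1 = L) :
    Rc y μ * Phi L N Rc lam (y + unitVec N μ) (Function.update j μ 0) - Phi L N Rc lam y j
      = ((L : ℂ))⁻¹ * cD N Rc lam y μ
        + ∑ ν, ((wt L (Function.update j μ (0 : Fin L) ν) : ℝ) : ℂ) * cD N Rc (fun z => cD N Rc lam z ν) y μ := by
  have hsw := sum_update_wt_sub L (fun ν => cD N Rc lam y ν) j μ 0
  have hw : 1 + (wt L ((0 : Fin L) : ℕ) - wt L (j μ)) = 1 / L := by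
    rw [Fin.val_zero]; exact one_add_wt_zero_sub L (j μ) h
  -- `Rc·D_ν λ(y+e_μ) = (D_μ D_ν λ)(y) + D_ν λ(y)`
  have hDD : ∀ ν, Rc y μ * cD N Rc lam (y + unitVec N μ) ν = cD N Rc (fun z => cD N Rc lam z ν) y μ + cD N Rc lam y ν := by
    intro ν; simp only [cD]; ring
  have hexp : Rc y μ * Phi L N Rc lam (y + unitVec N μ) (Function.update j μ 0)
      = Rc y μ * lam (y + unitVec N μ)
        + (∑ ν, ((wt L (Function.update j μ (0 : Fin L) ν) : ℝ) : ℂ) * cD N Rc (fun z => cD N Rc lam z ν) y μ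
          + ∑ ν, ((wt L (Function.update j μ (0 : Fin L) ν) : ℝ) : ℂ) * cD N Rc lam y ν) := by
    unfold Phi
    rw [mul_add, Finset.mul_sum, ← Finset.sum_add_distrib]
    congr 1
    refine Finset.sum_congr rfl fun ν _ => ?_
    rw [mul_left_comm, hDD, mul_add]
  have hcD : Rc y μ * lam (y + unitVec N μ) = cD N Rc lam y μ + lam y := by simp only [cD]; ring
  have hw' : (1 : ℂ) + (((wt L ((0 : Fin L) : ℕ) - wt L (j μ)) : ℝ) : ℂ) = ((L : ℂ))⁻¹ := by
    have := congrArg (fun r : ℝ => (r : ℂ)) hw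
    push_cast at this
    push_cast
    rw [this, one_div]
  rw [hexp, hcD]
  unfold Phi
  linear_combination hsw + cD N Rc lam y μ * hw'

end Objects

/-! ## §2 The transported constraint holds EXACTLY -/

section Constraint

variable (L : ℕ) [NeZero L] (N : Fin d → ℕ) [∀ μ, NeZero (N μ)] (Rc : Tor N → Fin d → ℂ) (lam : Tor N → ℂ)

omit [NeZero L] [∀ μ, NeZero (N μ)] in
/-- block sums of the interpolant: `Σ_j Φ(y, j) = L^d·λ(y)` (the weights are centred in every coordinate). [folklore] -/
theorem sum_Phi (y : Tor N) : ∑ j : Fin d → Fin L, Phi L N Rc lam y j = (L : ℂ) ^ d * lam y := by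
  have hcard : (Finset.univ : Finset (Fin d → Fin L)).card = L ^ d := by
    rw [Finset.card_univ, Fintype.card_fun, Fintype.card_fin, Fintype.card_fin]
  unfold Phi
  rw [Finset.sum_add_distrib, Finset.sum_const, hcard, nsmul_eq_mul, Nat.cast_pow, Finset.sum_comm]
  have h0 : ∀ ν : Fin d, ∑ j : Fin d → Fin L, ((wt L (j ν) : ℝ) : ℂ) * cD N Rc lam y ν = 0 := by
    intro ν
    rw [← Finset.sum_mul, ← Complex.ofReal_sum, sum_wt_coord L ν, Complex.ofReal_zero, zero_mul]
  rw [Finset.sum_congr rfl fun ν _ => h0 ν, Finset.sum_const_zero, add_zero]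

/-- **CONSTRAINT, EXACTLY**: `Qc L N T′ Λ′ = λ` for unit one-step transports (`T′·conj T′ = 1`, then `sum_Phi`). [folklore] -/
theorem Qc_interp {T' : Tor (fine L N) → ℂ} (hT1 : ∀ x, ‖T' x‖ = 1) :
    (fun y => Qc L N T' (interp L N T' Rc lam) y) = lam := by
  funext y
  have hL : ((L : ℂ) ^ d) ≠ 0 := pow_ne_zero _ (by exact_mod_cast NeZero.ne L)
  unfold Qc
  have hj : ∀ j : Fin d → Fin L, T' (bpt L N y j) * interp L N T' Rc lam (bpt L N y j) = Phi L N Rc lam y j := by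
    intro j
    rw [interp_bpt, ← mul_assoc, (mul_conj_of_norm_one (hT1 _)).1, one_mul]
  simp_rw [hj]
  rw [sum_Phi, ← mul_assoc, inv_mul_cancel₀ hL, one_mul]

end Constraint

/-! ## §3 The fine covariant differences of the competitor: exact splits and the pointwise bound -/

section Bonds

variable (L : ℕ) [NeZero L] (N : Fin d → ℕ) [∀ μ, NeZero (N μ)]

omit [NeZero L] [∀ μ, NeZero (N μ)] in
/-- the block-crossing split: `R′·conj T′(x′)·g(x′) − conj T′(x)·g(x) = conj T′(x)·(Rc·g(x′) − g(x)) + (R′·conj T′(x′)·T′(x) − Rc)·conj T′(x)·g(x′)`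
when `T′(x)·conj T′(x) = 1` (the in-block split is the UB⁺ file's `cov_diff_split`, `Rc = 1`). [folklore] -/
theorem cov_diff_split_cross {T' : Tor (fine L N) → ℂ} (hT1 : ∀ x, ‖T' x‖ = 1) (R' Rc : ℂ) (g : Tor (fine L N) → ℂ)
    (x x' : Tor (fine L N)) :
    R' * (conj (T' x') * g x') - conj (T' x) * g x
      = conj (T' x) * (Rc * g x' - g x) + (R' * conj (T' x') * T' x - Rc) * (conj (T' x) * g x') := by
  have h1 := (mul_conj_of_norm_one (hT1 x)).1
  linear_combination (-(R' * conj (T' x') * g x')) * h1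

variable (Rc : Tor N → Fin d → ℂ) (lam : Tor N → ℂ)

/-- the SECOND-ORDER part of the frame increment on a bond: zero in the block, `Σ_ν w_L(j⁰_ν)·(D⁺_μD⁺_νλ)(y)` across a face. [folklore] -/
def err2 (y : Tor N) (j : Fin d → Fin L) (μ : Fin d) : ℂ :=
  if (j μ : ℕ) + 1 = L then ∑ ν, ((wt L (Function.update j μ (0 : Fin L) ν) : ℝ) : ℂ) * cD N Rc (fun z => cD N Rc lam z ν) y μ else 0

/-- **POINTWISE BOUND** at `x = bpt y j`, direction `μ`, under unit transports and the two one-step defects `≤ m`: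
`|R′(x,μ)Λ′(x+e_μ) − Λ′(x)| ≤ |(1/L)(D⁺_μλ)(y) + err₂(y,j,μ)| + m·|Φ(block(x+e_μ), digits(x+e_μ))|`. [folklore] -/
theorem norm_cD_interp_le {T' : Tor (fine L N) → ℂ} (hT1 : ∀ x, ‖T' x‖ = 1) {R' : Tor (fine L N) → Fin d → ℂ} {m : ℝ}
    (hin : ∀ (y : Tor N) (j : Fin d → Fin L) (μ : Fin d), (j μ : ℕ) + 1 < L →
      ‖R' (bpt L N y j) μ * conj (T' (bpt L N y j + unitVec (fine L N) μ)) * T' (bpt L N y j) - 1‖ ≤ m)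
    (hcross : ∀ (y : Tor N) (j : Fin d → Fin L) (μ : Fin d), (j μ : ℕ) + 1 = L →
      ‖R' (bpt L N y j) μ * conj (T' (bpt L N y j + unitVec (fine L N) μ)) * T' (bpt L N y j) - Rc y μ‖ ≤ m)
    (y : Tor N) (j : Fin d → Fin L) (μ : Fin d) :
    ‖cD (fine L N) R' (interp L N T' Rc lam) (bpt L N y j) μ‖
      ≤ ‖((L : ℂ))⁻¹ * cD N Rc lam y μ + err2 L N Rc lam y j μ‖
        + m * ‖PhiF L N Rc lam (bpt L N y j + unitVec (fine L N) μ)‖ := by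
  set x := bpt L N y j with hx
  set x' := bpt L N y j + unitVec (fine L N) μ with hx'
  have hTx : ‖conj (T' x) * PhiF L N Rc lam x'‖ = ‖PhiF L N Rc lam x'‖ := by
    rw [norm_mul, Complex.norm_conj, hT1, one_mul]
  have hcD : cD (fine L N) R' (interp L N T' Rc lam) x μ = R' x μ * (conj (T' x') * PhiF L N Rc lam x') - conj (T' x) * PhiF L N Rc lam x := rfl
  by_cases hlt : (j μ : ℕ) + 1 < L
  · -- IN-BLOCK bond: increment `(1/L)·D_μλ(y)`, defect ≤ m, no second-order part
    have hne : ¬ ((j μ : ℕ) + 1 = L) := by omega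
    have hgx : PhiF L N Rc lam x = Phi L N Rc lam y j := PhiF_bpt L N Rc lam y j
    have hgx' : PhiF L N Rc lam x' = Phi L N Rc lam y (Function.update j μ ⟨(j μ : ℕ) + 1, hlt⟩) := by
      rw [hx', bpt_add_unitVec_of_lt L N y j μ hlt, PhiF_bpt]
    rw [err2, if_neg hne, add_zero, hcD, cov_diff_split L N hT1 (R' x μ) (PhiF L N Rc lam) x x']
    refine (norm_add_le _ _).trans (add_le_add ?_ ?_)
    · rw [norm_mul, Complex.norm_conj, hT1, one_mul, hgx, hgx', Phi_succ_sub L N Rc lam y j μ hlt]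
    · rw [norm_mul, hTx]
      exact mul_le_mul_of_nonneg_right (hin y j μ hlt) (norm_nonneg _)
  · -- CROSSING bond: increment `(1/L)·D_μλ(y) + err₂`, mismatch ≤ m
    have heq : (j μ : ℕ) + 1 = L := by have := (j μ).is_lt; omega
    have hgx : PhiF L N Rc lam x = Phi L N Rc lam y j := PhiF_bpt L N Rc lam y j
    have hgx' : PhiF L N Rc lam x' = Phi L N Rc lam (y + unitVec N μ) (Function.update j μ 0) := by
      rw [hx', bpt_add_unitVec_of_eq L N y j μ heq, PhiF_bpt]
    rw [err2, if_pos heq, hcD, cov_diff_split_cross L N hT1 (R' x μ) (Rc y μ) (PhiF L N Rc lam) x x']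
    refine (norm_add_le _ _).trans (add_le_add ?_ ?_)
    · rw [norm_mul, Complex.norm_conj, hT1, one_mul, hgx, hgx', Rc_mul_Phi_sub L N Rc lam y j μ heq]
    · rw [norm_mul, hTx]
      exact mul_le_mul_of_nonneg_right (hcross y j μ heq) (norm_nonneg _)

omit [∀ μ, NeZero (N μ)] in
/-- the second-order part is bounded by half the sum of the second covariant differences: `|err₂(y,j,μ)| ≤ ½Σ_ν |(D⁺_μD⁺_νλ)(y)|`,
and vanishes off the far face. [folklore] -/
theorem norm_err2_le (y : Tor N) (j : Fin d → Fin L) (μ : Fin d) :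
    ‖err2 L N Rc lam y j μ‖
      ≤ (if (j μ : ℕ) + 1 = L then (1 : ℝ) else 0) * ((1 / 2) * ∑ ν, ‖cD N Rc (fun z => cD N Rc lam z ν) y μ‖) := by
  unfold err2
  split_ifs with h
  · rw [one_mul, Finset.mul_sum]
    refine (norm_sum_le _ _).trans (Finset.sum_le_sum fun ν _ => ?_)
    rw [norm_mul, Complex.norm_real, Real.norm_eq_abs]
    exact mul_le_mul_of_nonneg_right (abs_wt_le L (Function.update j μ (0 : Fin L) ν).is_lt) (norm_nonneg _)
  · simp

end Bonds

/-! ## §4 The size of the interpolant -/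

section Size

variable (L : ℕ) [NeZero L] (N : Fin d → ℕ) [∀ μ, NeZero (N μ)] (Rc : Tor N → Fin d → ℂ) (lam : Tor N → ℂ)

omit [NeZero L] [∀ μ, NeZero (N μ)] in
/-- `|Φ(y,j)| ≤ |λ(y)| + ½Σ_ν(|λ(y+e_ν)| + |λ(y)|)` for contractive coarse phases. [folklore] -/
theorem norm_Phi_le (hRc : ∀ y μ, ‖Rc y μ‖ ≤ 1) (y : Tor N) (j : Fin d → Fin L) :
    ‖Phi L N Rc lam y j‖ ≤ ‖lam y‖ + (1 / 2) * ∑ ν, (‖lam (y + unitVec N ν)‖ + ‖lam y‖) := by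
  unfold Phi
  refine (norm_add_le _ _).trans (add_le_add le_rfl ?_)
  rw [Finset.mul_sum]
  refine (norm_sum_le _ _).trans (Finset.sum_le_sum fun ν _ => ?_)
  rw [norm_mul, Complex.norm_real, Real.norm_eq_abs]
  have hD : ‖cD N Rc lam y ν‖ ≤ ‖lam (y + unitVec N ν)‖ + ‖lam y‖ := by
    unfold cD
    refine (norm_sub_le _ _).trans (add_le_add ?_ le_rfl)
    rw [norm_mul]
    exact mul_le_of_le_one_left (norm_nonneg _) (hRc y ν)
  exact mul_le_mul (abs_wt_le L (j ν).is_lt) hD (norm_nonneg _) (by norm_num)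

/-- **SIZE OF THE INTERPOLANT**: `Σ_x |Φ(block x, digits x)|² ≤ 2(1 + d²)·L^d·Σ_y |λ(y)|²`. [folklore] -/
theorem nsq_PhiF_le (hRc : ∀ y μ, ‖Rc y μ‖ ≤ 1) :
    nsq (PhiF L N Rc lam) ≤ 2 * (1 + (d : ℝ) ^ 2) * ((L : ℝ) ^ d * nsq lam) := by
  have hshift : ∀ ν : Fin d, ∑ y : Tor N, ‖lam (y + unitVec N ν)‖ ^ 2 = nsq lam := fun ν =>
    Fintype.sum_equiv (Equiv.addRight (unitVec N ν)) _ _ fun y => rfl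
  -- pointwise: `|Φ(y,j)|² ≤ 2|λ y|² + 2·d·Σ_ν ¼(|λ(y+e_ν)| + |λ y|)² ≤ 2|λ y|² + d·Σ_ν (|λ(y+e_ν)|² + |λ y|²)`
  have hpt : ∀ (y : Tor N) (j : Fin d → Fin L),
      ‖Phi L N Rc lam y j‖ ^ 2 ≤ 2 * ‖lam y‖ ^ 2 + d * ∑ ν, (‖lam (y + unitVec N ν)‖ ^ 2 + ‖lam y‖ ^ 2) := by
    intro y j
    set a : ℝ := ‖lam y‖ with ha
    set b : Fin d → ℝ := fun ν => ‖lam (y + unitVec N ν)‖ + ‖lam y‖ with hb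
    have h1 : ‖Phi L N Rc lam y j‖ ≤ a + (1 / 2) * ∑ ν, b ν := norm_Phi_le L N Rc lam hRc y j
    have h0 : 0 ≤ a + (1 / 2) * ∑ ν, b ν := by positivity
    have h2 := pow_le_pow_left₀ (norm_nonneg _) h1 2
    have hcs : (∑ ν, b ν) ^ 2 ≤ d * ∑ ν, b ν ^ 2 := by
      have h := VariationalCovariantFederbush.sq_sum_le_card_mul (Finset.univ : Finset (Fin d)) b
      rwa [Finset.card_univ, Fintype.card_fin] at h
    have hb2 : ∀ ν, b ν ^ 2 ≤ 2 * (‖lam (y + unitVec N ν)‖ ^ 2 + ‖lam y‖ ^ 2) := fun ν => by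
      simp only [hb]; nlinarith [sq_nonneg (‖lam (y + unitVec N ν)‖ - ‖lam y‖)]
    have hsum : ∑ ν, b ν ^ 2 ≤ 2 * ∑ ν, (‖lam (y + unitVec N ν)‖ ^ 2 + ‖lam y‖ ^ 2) := by
      rw [Finset.mul_sum]; exact Finset.sum_le_sum fun ν _ => hb2 ν
    have hd : (0 : ℝ) ≤ d := Nat.cast_nonneg d
    nlinarith [h2, hcs, hsum, sq_nonneg (a - (1 / 2) * ∑ ν, b ν), mul_le_mul_of_nonneg_left hsum hd]
  have hcardR : (Fintype.card (Fin d → Fin L) : ℝ) = (L : ℝ) ^ d := by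
    rw [Fintype.card_fun, Fintype.card_fin, Fintype.card_fin]; push_cast; ring
  have hS : ∑ y : Tor N, ∑ ν : Fin d, (‖lam (y + unitVec N ν)‖ ^ 2 + ‖lam y‖ ^ 2) = 2 * d * nsq lam := by
    rw [Finset.sum_comm]
    have h1 : ∀ ν : Fin d, ∑ y : Tor N, (‖lam (y + unitVec N ν)‖ ^ 2 + ‖lam y‖ ^ 2) = 2 * nsq lam := by
      intro ν; rw [Finset.sum_add_distrib, hshift ν]; unfold nsq; ring
    rw [Finset.sum_congr rfl fun ν _ => h1 ν, Finset.sum_const, Finset.card_univ, Fintype.card_fin, nsmul_eq_mul]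
    ring
  have hY : ∑ y : Tor N, 2 * ‖lam y‖ ^ 2 = 2 * nsq lam := by unfold nsq; rw [Finset.mul_sum]
  unfold nsq
  rw [sum_blocks_real L N (fun x => ‖PhiF L N Rc lam x‖ ^ 2)]
  simp only [PhiF_bpt]
  calc ∑ y : Tor N, ∑ j : Fin d → Fin L, ‖Phi L N Rc lam y j‖ ^ 2
      ≤ ∑ y : Tor N, ∑ _j : Fin d → Fin L, (2 * ‖lam y‖ ^ 2 + d * ∑ ν, (‖lam (y + unitVec N ν)‖ ^ 2 + ‖lam y‖ ^ 2)) :=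
        Finset.sum_le_sum fun y _ => Finset.sum_le_sum fun j _ => hpt y j
    _ = ∑ y : Tor N, (Fintype.card (Fin d → Fin L) : ℝ) * (2 * ‖lam y‖ ^ 2 + d * ∑ ν, (‖lam (y + unitVec N ν)‖ ^ 2 + ‖lam y‖ ^ 2)) := by
        refine Finset.sum_congr rfl fun y _ => ?_
        rw [Finset.sum_const, Finset.card_univ, nsmul_eq_mul]
    _ = (Fintype.card (Fin d → Fin L) : ℝ) * (2 * nsq lam + d * (2 * d * nsq lam)) := by
        rw [← Finset.mul_sum, Finset.sum_add_distrib, hY, ← Finset.mul_sum, hS]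
    _ = 2 * (1 + (d : ℝ) ^ 2) * ((L : ℝ) ^ d * ∑ y : Tor N, ‖lam y‖ ^ 2) := by
        rw [hcardR]; unfold nsq; ring

end Size

/-! ## §5 Physical units: the regularity functional of leaf ONE⁺ on the level-`n` torus -/

section Phys

variable (n : ℕ) [NeZero n] (M : Fin d → ℕ) [∀ μ, NeZero (M μ)]

/-- the regularity functional of leaf ONE⁺ in physical units at level `n` (lattice spacing `n⁻¹`): `ρ(f) = n⁴/n^d · hess f` — an `H²`-type
seminorm of the coarse field built from FORWARD covariant second differences (`D⁺_μ D⁺_ν`, all ordered pairs). [folklore] -/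
def rho (Rc : Tor (fine n M) → Fin d → ℂ) (f : Tor (fine n M) → ℂ) : ℝ := (n : ℝ) ^ 4 / (n : ℝ) ^ d * hess (fine n M) Rc f

/-- `ρ ≥ 0`. [folklore] -/
theorem rho_nonneg (Rc : Tor (fine n M) → Fin d → ℂ) (f : Tor (fine n M) → ℂ) : 0 ≤ rho n M Rc f :=
  mul_nonneg (by positivity) (hess_nonneg _ _ _)

end Phys

end Summit.QuantumFields.BalabanUV.T4Continuum.VariationalCovariantInterpolant

end
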